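import Mathlib
import HarnessLib

/-!
# Polynomial factors are absorbed by a geometric gain: `sup_n (n + c)^k r^n < ∞` for `0 ≤ r < 1`

Elementary real analysis used by the volume-uniform two-kernel comparison of the [ABKM19] renormalisation step (line
`banach_two_kernel` of the child `TwoKernelSkBound` of the cruxes `HypACumulant` / `HypALocalTwoPoint`, route
`Summits/HubbardSuperconductivity/…/Theses/ComplexGFFStiffness`): the local pair property of Lemma 8.4
(`tayNormLE_fluct_sub_fluct_local_of_torusFRD`) carries a factor polynomial in the number `u = |U|_{k+1}` of blocks of the
target polymer, while the package condition `hc3A` used at the smaller block-product letter leaves a geometric room `λ^u`,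
`λ < 1` (`AbkmPackageLargeSetSlack`).  The product is bounded uniformly in `u`:

* `exists_nat_pow_mul_pow_le` — `∃ C > 0, ∀ n, n^k r^n ≤ C` (`0 ≤ r < 1`);
* `exists_nat_add_pow_mul_pow_le` — `∃ C > 0, ∀ n, (n + c)^k r^n ≤ C` (`0 < r < 1`, `c ≥ 0`).

Nothing about superconductivity in the Hubbard model.  Everything is proved; no named fact.

## References
* folklore (`n^k r^n → 0` for `|r| < 1`, Mathlib `tendsto_pow_const_mul_const_pow_of_abs_lt_one`); used for
  S. Adams, S. Buchholz, R. Kotecký, S. Müller, arXiv:1910.13564, Lemma 12.6 (12.53) [AdamsBuchholzKoteckyMuller2019].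
-/

noncomputable section

-- `Summit.<Summit>.<Problem>`: single-conjunct summit, the duplicate component is mandated (D-0017).
set_option linter.dupNamespace false

namespace Summit.HubbardSuperconductivity.HubbardSuperconductivity.Theorems.ComplexGFF

open Filter Topology
open scoped BigOperators

/-- **`sup_n n^k r^n < ∞`** for `0 ≤ r < 1`: there is `C > 0` with `n^k r^n ≤ C` for every `n : ℕ`. [folklore] -/
theorem exists_nat_pow_mul_pow_le {r : ℝ} (hr0 : 0 ≤ r) (hr : r < 1) (k : ℕ) :
    ∃ C : ℝ, 0 < C ∧ ∀ n : ℕ, (n : ℝ) ^ k * r ^ n ≤ C := by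
  have habs : |r| < 1 := abs_lt.2 ⟨by linarith, hr⟩
  have ht := tendsto_pow_const_mul_const_pow_of_abs_lt_one k habs
  have hev : ∀ᶠ n : ℕ in atTop, (n : ℝ) ^ k * r ^ n < 1 := ht.eventually (gt_mem_nhds zero_lt_one)
  obtain ⟨N, hN⟩ := Filter.eventually_atTop.1 hev
  refine ⟨1 + ∑ n ∈ Finset.range N, (n : ℝ) ^ k * r ^ n, ?_, ?_⟩
  · have : 0 ≤ ∑ n ∈ Finset.range N, (n : ℝ) ^ k * r ^ n :=
      Finset.sum_nonneg fun n _ => by positivity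
    linarith
  · intro n
    by_cases hn : N ≤ n
    · have h1 := hN n hn
      have : 0 ≤ ∑ m ∈ Finset.range N, (m : ℝ) ^ k * r ^ m :=
        Finset.sum_nonneg fun m _ => by positivity
      linarith
    · have hmem : n ∈ Finset.range N := Finset.mem_range.2 (by omega)
      have hle : (n : ℝ) ^ k * r ^ n ≤ ∑ m ∈ Finset.range N, (m : ℝ) ^ k * r ^ m :=
        Finset.single_le_sum (f := fun m : ℕ => (m : ℝ) ^ k * r ^ m) (fun m _ => by positivity) hmem
      linarith

/-- **`sup_n (n + c)^k r^n < ∞`** for `0 < r < 1`, `c ≥ 0`: there is `C > 0` with `(n + c)^k r^n ≤ C` for every `n : ℕ`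
(`n + c ≤ (1 + c)(n + 1)` and `(n+1)^k r^n = r^{−1}·(n+1)^k r^{n+1}`). [folklore] -/
theorem exists_nat_add_pow_mul_pow_le {r c : ℝ} (hr0 : 0 < r) (hr : r < 1) (hc : 0 ≤ c) (k : ℕ) :
    ∃ C : ℝ, 0 < C ∧ ∀ n : ℕ, ((n : ℝ) + c) ^ k * r ^ n ≤ C := by
  obtain ⟨C₀, hC₀, hb⟩ := exists_nat_pow_mul_pow_le hr0.le hr k
  refine ⟨(1 + c) ^ k * (r⁻¹ * C₀), by positivity, fun n => ?_⟩
  have h1 : (n : ℝ) + c ≤ (1 + c) * ((n : ℝ) + 1) := by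
    have hn : (0 : ℝ) ≤ n := Nat.cast_nonneg n
    nlinarith
  have h0 : 0 ≤ (n : ℝ) + c := by positivity
  have hpow : ((n : ℝ) + c) ^ k ≤ (1 + c) ^ k * ((n : ℝ) + 1) ^ k := by
    rw [← mul_pow]; exact pow_le_pow_left₀ h0 h1 k
  have hnext := hb (n + 1)
  push_cast at hnext
  have hrn : 0 ≤ r ^ n := pow_nonneg hr0.le n
  have key : ((n : ℝ) + 1) ^ k * r ^ n ≤ r⁻¹ * C₀ := by
    rw [le_inv_mul_iff₀ hr0]
    calc r * (((n : ℝ) + 1) ^ k * r ^ n) = ((n : ℝ) + 1) ^ k * r ^ (n + 1) := by rw [pow_succ]; ring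
      _ ≤ C₀ := hnext
  calc ((n : ℝ) + c) ^ k * r ^ n ≤ (1 + c) ^ k * ((n : ℝ) + 1) ^ k * r ^ n :=
        mul_le_mul_of_nonneg_right hpow hrn
    _ = (1 + c) ^ k * (((n : ℝ) + 1) ^ k * r ^ n) := by ring
    _ ≤ (1 + c) ^ k * (r⁻¹ * C₀) := mul_le_mul_of_nonneg_left key (by positivity)

end Summit.HubbardSuperconductivity.HubbardSuperconductivity.Theorems.ComplexGFF

end
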